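import Summits.HodgeConjecture.HodgeConjecture.Theorems.H413AdmissibleLineSign
import Summits.HodgeConjecture.HodgeCM.Model.ArchLineOrient
import HarnessLib

/-!
# FLOOR-0 P4, seat S4′(i) — the SLOT SIGN `hpos` of the model AT THE ADMISSIBLE LINE of a triple (TASK 0, model currency)

Cell hodgecm-mathlib (D-0151), FLOOR 0, crux item H413 = stmt-HodgeConjecture-24833; programme P4, line
`Cruxes/H413/Lines/F0_P4AdmissibleOccursInH1.lean`, stub S4′ `stub_T3a_holThetaRealisationOfRallisAt` (node `StubT3aHolThetaRealisationAt`).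
Author F0P4-p01 (g0); sequel of ★ `Theorems/H413AdmissibleLineSign` (p791505).  `--supports stmt-HodgeConjecture-24833`.  DEF-FREE.

DECISIONS-T3a v1 (F0P4-plan (g0)) D1 asked for the slot condition of the model's harmonic family at the line of a triple,
`hpos : 0 < cmXW L (frameD V) (lineVec L d) _ ι₁ (cmPlace L ι₁) 0` (the input of ★ `ArchSideTerm.posIdxEquivUnit` ∕ `negIdxEquivEmpty`,
hence of ★ `harm_lineOmega_zeroG`'s `eR`∕`eS` and of ★ `lineVacExponentsZero`), read against the `ι₁`-class of the triple; D1 AMENDED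
(F0P4-plan 21:47:47Z) puts it at the ADMISSIBLE line `d = e · 2·imagUnit L` of ★ `AdmissibleLine.exists_admissibleLine`.  This file proves it
there, in closed form and WITHOUT the orientation hypothesis:

* `re_embedding_div_im_embedding_mk` — at the admissible line the model's closed form ★ `ArchSideTerm.cmXW_cmPlace_lineVec`
  (`x_W(v₁) 0 = re ι₁(d) ∕ im((mk ι₁).embedding δ_L)`) evaluates to `∓ 2 · im ι₁(e)` according as Mathlib's representative
  `(InfinitePlace.mk ι₁).embedding` is `ι₁` or `conjugate ι₁` (the two `im(δ_L)` factors cancel);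
* **`cmXW_cmPlace_admissibleLine_pos_iff`** — for a `Φ`-admissible `e` (★ `IsAdmissibleElement L Φ.1 e`):
  `0 < cmXW L (frameD V) (lineVec L (e · 2·imagUnit L)) _ ι₁ (cmPlace L ι₁) 0 ↔ (InfinitePlace.mk ι₁).embedding ∈ Φ.1`
  — choice-robust: it names Mathlib's representative instead of deciding it;
* `cmXW_cmPlace_admissibleLine_pos_iff_of_embedding_eq` — under the model's standing `hemb : (mk ι₁).embedding = ι₁` this reads `… ↔ ι₁ ∈ Φ.1`
  (DISJUNCT A of the node), and `cmXW_cmPlace_admissibleLine_pos_of_mem` packages the `hpos` input;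
* `exists_admissibleLine_hpos_iff` — AT THE PIN `datum413 hDel F V a₀ Φ i`: every admissible triple `t` has an admissible line `a`
  (`locF a = t.ε`) with `0 < cmXW … (lineVec ↑a) … 0 ↔ (mk ι₁).embedding ∈ Φ_μ(t)`.

So the MASTER statement of S4′ (SEAT-i MEMO v1 §1; endorsed F0P4-plan 21:47:47Z (2)) carries exactly the hypothesis under which the model's
slot-0 harmonic family exists at the admissible line.  HC_CM is proved only modulo the printed citations until rung 0 closes; nothing here is cited
as a fact.

## References
* [Liu2021] Y. Liu, *Fourier–Jacobi cycles and arithmetic relative trace formula*, Camb. J. Math. 9 (2021) = arXiv:2102.11518 — Def. 4.12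
  (ll. 2102–2108), App. D Lem. D.2 (2).
* Tree: ★ `Theorems/H413AdmissibleLineSign` (`IsAdmissibleElement.mem_iff_im_pos`, `im_neg_of_mem`, `im_pos_of_notMem`, `re_embedding_lineScalar`,
  `complexConj_lineScalar`, `exists_admissibleLine`), ★ `HodgeCM/Model/ArchLineOrient` (`cmXW_cmPlace_lineVec`, `im_embedding_mk_imagUnit_ne_zero`),
  ★ `HodgeCM/Model/ArchLineDatumOf_1` (`posIdxEquivUnit`, `negIdxEquivEmpty`), Mathlib `NumberField.InfinitePlace.embedding_mk_eq`.
-/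

set_option autoImplicit false
set_option linter.dupNamespace false

noncomputable section

open NumberField NumberField.InfinitePlace
open scoped ComplexConjugate
open Literature.AlgebraicGeometry.Motives (CMType)
open Literature.AlgebraicGeometry.Liu2021 (IsAdmissibleElement)
open Literature.NumberTheory.Automorphic.Liu2021.Def411WeilCarriers (Eps locF epsOf)
open Literature.NumberTheory.GelbartRogawski1991.UnitaryDualPair (imagUnit imagUnitSq complexConj_imagUnit imagUnit_ne_zero lineVec)
open HodgeCM HodgeCM.Model HodgeCM.Model.HypCensus HodgeCM.Model.ArchSideTerm

namespace Summit.HodgeConjecture.HodgeConjecture.Cruxes.H413.AdmissibleLine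

/-! ## §1 The model's closed form evaluated at the admissible line -/

section Model

variable {L : CMField} {ι₁ : L →+* ℂ} (V : HermSpace3 L ι₁)

/-- the imaginary part of `δ_L` under Mathlib's representative embedding of the place of `ι₁` is `± im ι₁(δ_L)`:
`= im ι₁(δ_L)` if `(mk ι₁).embedding = ι₁`, `= − im ι₁(δ_L)` if it is `conjugate ι₁`. [folklore] -/
theorem im_embedding_mk_imagUnit_eq_or :
    (((InfinitePlace.mk ι₁).embedding (imagUnit (L : Type))).im = (ι₁ (imagUnit (L : Type))).im ∧
        (InfinitePlace.mk ι₁).embedding = ι₁) ∨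
      (((InfinitePlace.mk ι₁).embedding (imagUnit (L : Type))).im = -(ι₁ (imagUnit (L : Type))).im ∧
        (InfinitePlace.mk ι₁).embedding = ComplexEmbedding.conjugate ι₁) := by
  rcases InfinitePlace.embedding_mk_eq ι₁ with h | h
  · exact Or.inl ⟨by rw [h], h⟩
  · exact Or.inr ⟨by rw [h, im_conjugate_embedding], h⟩

/-- **the slot sign at the admissible line, closed form.**  For purely imaginary `e` the model's `x_W(v₁) 0` at the line `e · 2δ_L` is
`−2 · im ι₁(e)` when `(mk ι₁).embedding = ι₁` and `+2 · im ι₁(e)` when it is `conjugate ι₁`.  [folklore] -/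
theorem cmXW_cmPlace_admissibleLine_eq {e : (L : Type)} (he : IsCMField.complexConj (L : Type) e = -e) :
    (cmXW (L : Type) (frameD V) (lineVec (L : Type) (e * (2 * imagUnit (L : Type))))
          (fun _ => complexConj_lineScalar (complexConj_imagUnit (L : Type)) he) ι₁ (cmPlace (L : Type) ι₁) 0 =
        -2 * (ι₁ e).im ∧ (InfinitePlace.mk ι₁).embedding = ι₁) ∨
      (cmXW (L : Type) (frameD V) (lineVec (L : Type) (e * (2 * imagUnit (L : Type))))
          (fun _ => complexConj_lineScalar (complexConj_imagUnit (L : Type)) he) ι₁ (cmPlace (L : Type) ι₁) 0 =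
        2 * (ι₁ e).im ∧ (InfinitePlace.mk ι₁).embedding = ComplexEmbedding.conjugate ι₁) := by
  have hδ := im_embedding_ne_zero_of_skew (complexConj_imagUnit (L : Type)) (imagUnit_ne_zero (L : Type)) ι₁
  rw [cmXW_cmPlace_lineVec V _ (complexConj_lineScalar (complexConj_imagUnit (L : Type)) he),
    re_embedding_lineScalar (complexConj_imagUnit (L : Type)) he ι₁]
  rcases im_embedding_mk_imagUnit_eq_or (L := L) (ι₁ := ι₁) with ⟨h, hι⟩ | ⟨h, hι⟩
  · refine Or.inl ⟨?_, hι⟩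
    rw [h]
    field_simp
  · refine Or.inr ⟨?_, hι⟩
    rw [h]
    field_simp

/-- **THE SLOT SIGN DECIDED (choice-robust form).**  For a `Φ`-admissible `e`, the model's slot-0 positivity at the admissible line `e · 2δ_L`
holds iff Mathlib's representative embedding of the place of `ι₁` lies in `Φ`. [cite: Liu2021, Def. 4.12 (ll. 2102–2108); App. D Lem. D.2 (2)] -/
theorem cmXW_cmPlace_admissibleLine_pos_iff (Φ : CMType (L : Type)) {e : (L : Type)} (he : IsAdmissibleElement (L : Type) Φ.1 e) :
    0 < cmXW (L : Type) (frameD V) (lineVec (L : Type) (e * (2 * imagUnit (L : Type))))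
          (fun _ => complexConj_lineScalar (complexConj_imagUnit (L : Type)) he.2.1) ι₁ (cmPlace (L : Type) ι₁) 0 ↔
      (InfinitePlace.mk ι₁).embedding ∈ Φ.1 := by
  rcases cmXW_cmPlace_admissibleLine_eq V he.2.1 with ⟨h, hι⟩ | ⟨h, hι⟩
  · rw [h, hι]
    constructor
    · intro hx
      by_contra hτ
      have := im_pos_of_notMem Φ he hτ
      linarith
    · intro hτ
      have := im_neg_of_mem he hτ
      linarith
  · rw [h, hι, conjugate_mem_cmType_iff]
    constructor
    · intro hx hτ
      have := im_neg_of_mem he hτ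
      linarith
    · intro hτ
      have := im_pos_of_notMem Φ he hτ
      linarith

/-- under the model's standing orientation hypothesis `hemb : (mk ι₁).embedding = ι₁` (★ `harm_lineOmega_zeroG`), the slot sign at the admissible
line is `ι₁ ∈ Φ` — DISJUNCT A of `StubT3aHolThetaRealisationAt`. [cite: Liu2021, Def. 4.12 (ll. 2102–2108); App. D Lem. D.2 (2)] -/
theorem cmXW_cmPlace_admissibleLine_pos_iff_of_embedding_eq (hemb : (InfinitePlace.mk ι₁).embedding = ι₁) (Φ : CMType (L : Type))
    {e : (L : Type)} (he : IsAdmissibleElement (L : Type) Φ.1 e) :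
    0 < cmXW (L : Type) (frameD V) (lineVec (L : Type) (e * (2 * imagUnit (L : Type))))
          (fun _ => complexConj_lineScalar (complexConj_imagUnit (L : Type)) he.2.1) ι₁ (cmPlace (L : Type) ι₁) 0 ↔
      ι₁ ∈ Φ.1 := by
  rw [cmXW_cmPlace_admissibleLine_pos_iff V Φ he, hemb]

/-- **`hpos` at the admissible line** (the input of ★ `posIdxEquivUnit` ∕ `negIdxEquivEmpty`, hence `eR`∕`eS` of ★ `harm_lineOmega_zeroG`):
from `(mk ι₁).embedding ∈ Φ`. [cite: Liu2021, Def. 4.12 (ll. 2102–2108); App. D Lem. D.2 (2)] -/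
theorem cmXW_cmPlace_admissibleLine_pos_of_mem (Φ : CMType (L : Type)) {e : (L : Type)} (he : IsAdmissibleElement (L : Type) Φ.1 e)
    (hmem : (InfinitePlace.mk ι₁).embedding ∈ Φ.1) :
    0 < cmXW (L : Type) (frameD V) (lineVec (L : Type) (e * (2 * imagUnit (L : Type))))
          (fun _ => complexConj_lineScalar (complexConj_imagUnit (L : Type)) he.2.1) ι₁ (cmPlace (L : Type) ι₁) 0 :=
  (cmXW_cmPlace_admissibleLine_pos_iff V Φ he).2 hmem

/-- conversely the slot sign is NEGATIVE at the admissible line iff the representative embedding is OFF `Φ` (the line is never isotropic at `v₁`).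
[cite: Liu2021, Def. 4.12 (ll. 2102–2108)] -/
theorem cmXW_cmPlace_admissibleLine_neg_iff (Φ : CMType (L : Type)) {e : (L : Type)} (he : IsAdmissibleElement (L : Type) Φ.1 e) :
    cmXW (L : Type) (frameD V) (lineVec (L : Type) (e * (2 * imagUnit (L : Type))))
          (fun _ => complexConj_lineScalar (complexConj_imagUnit (L : Type)) he.2.1) ι₁ (cmPlace (L : Type) ι₁) 0 < 0 ↔
      (InfinitePlace.mk ι₁).embedding ∉ Φ.1 := by
  rw [← cmXW_cmPlace_admissibleLine_pos_iff V Φ he, not_lt]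
  rcases cmXW_cmPlace_admissibleLine_eq V he.2.1 with ⟨h, -⟩ | ⟨h, -⟩
  · rw [h]
    rcases lt_or_gt_of_ne (im_embedding_ne_zero_of_skew he.2.1 he.1 ι₁) with h1 | h1
    · exact ⟨fun h2 => by linarith, fun h2 => by linarith⟩
    · exact ⟨fun h2 => by linarith, fun h2 => lt_of_le_of_ne h2 (by intro h3; apply h1.ne'; linarith)⟩
  · rw [h]
    rcases lt_or_gt_of_ne (im_embedding_ne_zero_of_skew he.2.1 he.1 ι₁) with h1 | h1
    · exact ⟨fun h2 => by linarith, fun h2 => lt_of_le_of_ne h2 (by intro h3; apply h1.ne; linarith)⟩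
    · exact ⟨fun h2 => by linarith, fun h2 => by linarith⟩

end Model

/-! ## §2 At the pin `datum413 hDel F V a₀ Φ i` -/

section Pin

open HodgeCM.Model.LiuIndex HodgeCM.Model.TowerCarrier
open Summit.HodgeConjecture.CorCM Summit.HodgeConjecture.CorCM.Transposition
open Summit.HodgeConjecture.CorCM.Model
open Literature.NumberTheory.Automorphic Literature.NumberTheory.Automorphic.Liu2021
open Summit.HodgeConjecture.CorCM.Lines.A3Liu413 (datum413)

set_option synthInstance.maxHeartbeats 400000 in
set_option maxHeartbeats 8000000 in
/-- **THE ADMISSIBLE LINE OF A TRIPLE WITH ITS SLOT SIGN, AT THE PIN.**  Every admissible triple `t` of the pin has a witness `e` and a global real unit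
`a = ⟨e · 2·imagUnit⟩ ∈ (L⁺)ˣ` (`L = K F`) with `locF a = t.ε` and, at the place of `ι₁`, the model's slot-0 sign of the line `⟨↑a⟩` POSITIVE iff Mathlib's
representative `(mk ι₁).embedding` lies in `Φ_μ(t)` — so under `hemb : (mk ι₁).embedding = ι₁`, iff `ι₁ ∈ Φ_μ(t)`.
[cite: Liu2021, Def. 4.12 (ll. 2102–2108); App. D Lem. D.2 (2)] -/
theorem exists_admissibleLine_hpos_iff
    (hDel : Literature.AlgebraicGeometry.ShimuraVarieties.UnitaryCanonicalModel.canonicalModel_exists_printed)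
    (F : HodgeCM.CMField) [IsGalois ℚ F] {ι₁ : F →+* ℂ} (V : HodgeCM.HermSpace3 F ι₁) (a₀ : RealScalar F) (Φ : CMType F)
    (i : (I V (repAt a₀) (muLiu ι₁ GramClass.rep))) (t : (datum413 hDel F V a₀ Φ i).Triple) (ht : t.IsAdmissible) :
    ∃ (e : HodgeCM.CMField.K F) (he : IsCMField.complexConj (HodgeCM.CMField.K F) e = -e)
      (a : (↥(maximalRealSubfield (HodgeCM.CMField.K F)))ˣ),
      IsAdmissibleElement (HodgeCM.CMField.K F) t.cmType.1 e ∧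
        locF (↥(maximalRealSubfield (HodgeCM.CMField.K F))) (imagUnitSq (HodgeCM.CMField.K F)) a = t.ε ∧
          ((a : ↥(maximalRealSubfield (HodgeCM.CMField.K F))) : HodgeCM.CMField.K F) = e * (2 * imagUnit (HodgeCM.CMField.K F)) ∧
            (0 < cmXW (HodgeCM.CMField.K F) (frameD V) (lineVec (HodgeCM.CMField.K F) (e * (2 * imagUnit (HodgeCM.CMField.K F))))
                  (fun _ => complexConj_lineScalar (complexConj_imagUnit (HodgeCM.CMField.K F)) he) ι₁ (cmPlace (HodgeCM.CMField.K F) ι₁) 0 ↔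
              (InfinitePlace.mk ι₁).embedding ∈ t.cmType.1) := by
  obtain ⟨e, a, he, hloc, ha, -⟩ := exists_admissibleLine hDel F V a₀ Φ i t ht
  exact ⟨e, he.2.1, a, he, hloc, ha, cmXW_cmPlace_admissibleLine_pos_iff V t.cmType he⟩

end Pin

end Summit.HodgeConjecture.HodgeConjecture.Cruxes.H413.AdmissibleLine

end
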